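import Mathlib
import Summits.Ventures.HodgeRepro.Tier4.Target
import Summits.Ventures.HodgeRepro.Tier4.Common.TargetData
import Summits.Ventures.HodgeRepro.Tier4.Common.AutForms
import Summits.Ventures.HodgeRepro.Tier4.LitCompactness
import Summits.Ventures.HodgeRepro.Tier4.Line4.MixedTransfer
import Summits.Ventures.HodgeRepro.Tier4.Line4.Forms11
import Summits.Ventures.HodgeRepro.Tier4.Line4.MixedInvariant
import Summits.Ventures.HodgeRepro.Tier4.Line4.DomainUnfold
import Summits.Ventures.HodgeRepro.Tier4.Line4.Partition
import Summits.Ventures.HodgeRepro.Tier4.Line4.QuotientTiling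
import Summits.Ventures.HodgeRepro.Tier4.Line4.Cohomology11
import Summits.Ventures.HodgeRepro.Tier4.Line4.PairDescends

/-!
# Tier4/Line4/PairIndependent — the `(1,1)`-pairing of cocycles does not depend on the fundamental domain
(the `hind` hypothesis of the skeleton's `costume_of_conclusion`, as a THEOREM under (K)+(P))

Blind re-derivation cell `pub-hodge-repro`, Tier 4 (README §9–§10), seat t4-L4-p2 (prover, LINE L4, gen 0).  Tree path
`lean/Summits/Ventures/HodgeRepro/Tier4/Line4/PairIndependent.lean`.  `pair11_domain_independent`: for every level `Γ′`,
fundamental domains `D, D′` of `Γ′` and cocycles `ξ, ξ′ ∈ Z11 d Γ′`, `pair11 D ξ ξ′ = pair11 D′ ξ ξ′` — the density of two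
invariant forms is invariant (`density_invariant_of_pull`), so the unfolding (`setIntegral_domain_eq_of_invariant`,
`DomainUnfold`) gives it for basic cocycles, and `Submodule.span_induction₂` extends it to the spans (with the
integrability of every basic pair on both domains, `integrableOn_wedge_of_invariant`).

Nothing here says anything about the status of the Hodge conjecture for CM abelian varieties, which is NOT proved
(HC_CM is NOT proved by anyone in this repository).
-/

set_option autoImplicit false

noncomputable section

open Matrix MeasureTheory NumberField Topology Set
open scoped ComplexConjugate ComplexOrder

namespace Summit.Ventures.HodgeRepro.Tier4.Line4

open Summit.Ventures.HodgeRepro.Tier4 Summit.Ventures.HodgeRepro.Tier4.Line3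

variable {F E : Type} [Field F] [NumberField F] [IsGalois ℚ F] [IsCMField F]
  [Field E] [NumberField E] [IsGalois ℚ E] [IsCMField E] (d : TargetData F E)

/-- **Independence of the fundamental domain** for the pairing of two basic cocycles. -/
theorem pair11_basic_domain_independent (hK : Lit.BorelHarishChandra1962_Thm11_8_cocompact_hdef E d.H d.τ₀ d.C)
    (hP : Lit.BorelHarishChandra1962_properlyDiscontinuous_hdef E d.H d.τ₀ d.C)
    {Γ' : Set (Matrix (Fin 3) (Fin 3) E)} (hΓ' : d.IsLevel Γ') {D D' : Set (Fin 2 → ℂ)} (hD : d.IsDomain Γ' D)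
    (hD' : d.IsDomain Γ' D') {a b : Forms11} (ha : ∀ φ ∈ ballActions d.τ₀ d.C Γ', ∀ z ∈ ball, pull φ a z = a z)
    (hb : ∀ φ ∈ ballActions d.τ₀ d.C Γ', ∀ z ∈ ball, pull φ b z = b z)
    (hac : ∀ k l, ContinuousOn (fun z => a z k l) ball) (hbc : ∀ k l, ContinuousOn (fun z => b z k l) ball) :
    ∫ z in D, wedgeCoeff11 (a z) (b z) = ∫ z in D', wedgeCoeff11 (a z) (b z) := by
  obtain ⟨χ, -, hχcont, hχ0, ⟨K₁, hK₁c, hK₁b, hχK₁⟩, hpart, -⟩ :=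
    exists_partition hΓ'.1 (hτ_of_datum d) d.hC (cocompact_of_lit d hK hΓ') (properlyDiscontinuous_of_lit d hP hΓ')
  exact setIntegral_domain_eq_of_invariant hΓ'.1 (hτ_of_datum d) d.hC hD hD' (continuousOn_wedgeCoeff11 hac hbc)
    (density_invariant_of_pull d ha hb hΓ'.1 rfl) hχcont hχ0 hK₁c hK₁b hχK₁ hpart

/-- **`hind`**: the pairing of cocycles does not depend on the fundamental domain. -/
theorem pair11_domain_independent (hK : Lit.BorelHarishChandra1962_Thm11_8_cocompact_hdef E d.H d.τ₀ d.C)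
    (hP : Lit.BorelHarishChandra1962_properlyDiscontinuous_hdef E d.H d.τ₀ d.C)
    (Γ' : Set (Matrix (Fin 3) (Fin 3) E)) (hΓ' : d.IsLevel Γ') (D D' : Set (Fin 2 → ℂ)) (hD : d.IsDomain Γ' D)
    (hD' : d.IsDomain Γ' D') (ξ ξ' : Forms11) (hξ : ξ ∈ Z11 d Γ') (hξ' : ξ' ∈ Z11 d Γ') :
    pair11 D ξ ξ' = pair11 D' ξ ξ' := by
  have hDb : D ⊆ ball := hD.2.1
  have hDm : MeasurableSet D := hD.1
  have hDb' : D' ⊆ ball := hD'.2.1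
  have hDm' : MeasurableSet D' := hD'.1
  have hξZ : ξ ∈ Submodule.span ℂ
    {ζ | ∃ ξ : Forms11, Smooth11 ξ ∧ IsClosed11 ξ ∧ IsInvariant11 d Γ' ξ ∧ ζ = onBall ξ} := hξ
  have hξ'Z : ξ' ∈ Submodule.span ℂ
    {ζ | ∃ ξ : Forms11, Smooth11 ξ ∧ IsClosed11 ξ ∧ IsInvariant11 d Γ' ξ ∧ ζ = onBall ξ} := hξ'
  refine Submodule.span_induction₂ (p := fun a b _ _ =>
    IntegrableOn (fun z => wedgeCoeff11 (a z) (b z)) D ∧ IntegrableOn (fun z => wedgeCoeff11 (a z) (b z)) D' ∧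
      pair11 D a b = pair11 D' a b) ?_ ?_ ?_ ?_ ?_ ?_ ?_ hξZ hξ'Z |>.2.2
  · rintro a b ⟨ξ₁, hs₁, -, hi₁, rfl⟩ ⟨ξ₂, hs₂, -, hi₂, rfl⟩
    have i1 := integrableOn_wedge_of_invariant d hK hP hΓ' hD (invariant11_of_datum d hi₁)
      (invariant11_of_datum d hi₂) (continuousOn_entry_of_smooth11 hs₁) (continuousOn_entry_of_smooth11 hs₂)
    have i2 := integrableOn_wedge_of_invariant d hK hP hΓ' hD' (invariant11_of_datum d hi₁)
      (invariant11_of_datum d hi₂) (continuousOn_entry_of_smooth11 hs₁) (continuousOn_entry_of_smooth11 hs₂)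
    refine ⟨i1.congr_fun (fun z hz => by simp only [onBall_apply_of_mem _ (hDb hz)]) hDm,
      i2.congr_fun (fun z hz => by simp only [onBall_apply_of_mem _ (hDb' hz)]) hDm', ?_⟩
    show ∫ z in D, wedgeCoeff11 (onBall ξ₁ z) (onBall ξ₂ z) = ∫ z in D', wedgeCoeff11 (onBall ξ₁ z) (onBall ξ₂ z)
    rw [setIntegral_congr_fun hDm fun z hz => by simp only [onBall_apply_of_mem _ (hDb hz)]; rfl,
      setIntegral_congr_fun hDm' fun z hz => by simp only [onBall_apply_of_mem _ (hDb' hz)]; rfl]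
    exact pair11_basic_domain_independent d hK hP hΓ' hD hD' (invariant11_of_datum d hi₁)
      (invariant11_of_datum d hi₂) (continuousOn_entry_of_smooth11 hs₁) (continuousOn_entry_of_smooth11 hs₂)
  · intro y _
    refine ⟨?_, ?_, ?_⟩
    · simp only [Pi.zero_apply, wedgeCoeff11_zero_left]; exact integrableOn_zero
    · simp only [Pi.zero_apply, wedgeCoeff11_zero_left]; exact integrableOn_zero
    · simp only [pair11, Pi.zero_apply, wedgeCoeff11_zero_left, integral_zero]
  · intro x _
    refine ⟨?_, ?_, ?_⟩
    · simp only [Pi.zero_apply, wedgeCoeff11_zero_right]; exact integrableOn_zero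
    · simp only [Pi.zero_apply, wedgeCoeff11_zero_right]; exact integrableOn_zero
    · simp only [pair11, Pi.zero_apply, wedgeCoeff11_zero_right, integral_zero]
  · intro x y z _ _ _ ⟨hxi, hxi', hx⟩ ⟨hyi, hyi', hy⟩
    refine ⟨?_, ?_, ?_⟩
    · simp only [Pi.add_apply, wedgeCoeff11_add_left]; exact hxi.add hyi
    · simp only [Pi.add_apply, wedgeCoeff11_add_left]; exact hxi'.add hyi'
    · simp only [pair11, Pi.add_apply, wedgeCoeff11_add_left] at hx hy ⊢
      rw [integral_add hxi hyi, integral_add hxi' hyi', hx, hy]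
  · intro x y z _ _ _ ⟨hxi, hxi', hx⟩ ⟨hyi, hyi', hy⟩
    refine ⟨?_, ?_, ?_⟩
    · simp only [Pi.add_apply, wedgeCoeff11_add_right]; exact hxi.add hyi
    · simp only [Pi.add_apply, wedgeCoeff11_add_right]; exact hxi'.add hyi'
    · simp only [pair11, Pi.add_apply, wedgeCoeff11_add_right] at hx hy ⊢
      rw [integral_add hxi hyi, integral_add hxi' hyi', hx, hy]
  · intro r x y _ _ ⟨hxi, hxi', hx⟩
    refine ⟨?_, ?_, ?_⟩
    · simp only [Pi.smul_apply, wedgeCoeff11_smul_left]; exact hxi.const_mul r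
    · simp only [Pi.smul_apply, wedgeCoeff11_smul_left]; exact hxi'.const_mul r
    · simp only [pair11, Pi.smul_apply, wedgeCoeff11_smul_left] at hx ⊢
      rw [integral_const_mul, integral_const_mul, hx]
  · intro r x y _ _ ⟨hxi, hxi', hx⟩
    refine ⟨?_, ?_, ?_⟩
    · simp only [Pi.smul_apply, wedgeCoeff11_smul_right]; exact hxi.const_mul r
    · simp only [Pi.smul_apply, wedgeCoeff11_smul_right]; exact hxi'.const_mul r
    · simp only [pair11, Pi.smul_apply, wedgeCoeff11_smul_right] at hx ⊢
      rw [integral_const_mul, integral_const_mul, hx]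

end Summit.Ventures.HodgeRepro.Tier4.Line4

end
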